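import Literature.MathematicalPhysics.QuantumLattice.FinDimSpectrum

/-!
# Sketch — crux idea «odd-deformation EOM transfer» (hub-lb-sym-idea-1, crux `LowerEdge_ge_m4o5`)

First lemma of the line, stated over existing declarations (`Matrix.minEnergyOn`,
`Literature/MathematicalPhysics/QuantumLattice/FinDimSpectrum.lean`). Not proved here.
-/

namespace Summit.Ventures.CertifiedManyBodySolver.Cruxes.LowerEdge_ge_m4o5.OddDeformation

open Matrix

/-- FIRST LEMMA (transfer). If a unitary `g` preserves the sector `K`, commutes with `H` and
ANTIcommutes with `V`, then deforming `H` by `ε • V` cannot raise the sector minimum energy: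
`E_K(H + εV) ≤ E_K(H)` for every real `ε` (the symmetric point is the maximum of an even concave
function). Proof sketch: the minimisers of the Rayleigh quotient of the compression of `H` to `K`
form a `g`-invariant subspace; a `g`-eigenvector `ψ` in it has `⟨ψ, Vψ⟩ = -⟨ψ, Vψ⟩ = 0`, so it is a
trial state for `H + εV` with energy `E_K(H)`. Junk-safe: for `K = ⊥` both sides are `sInf ∅`. -/
def OddDeformationTransfer : Prop :=
  ∀ (n : Type) [Fintype n] [DecidableEq n] (H V g : Matrix n n ℂ) (K : Submodule ℂ (n → ℂ)),
    H.IsHermitian → V.IsHermitian → gᴴ * g = 1 → g * H = H * g → g * V = -(V * g) →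
    (∀ ψ ∈ K, g *ᵥ ψ ∈ K) →
    ∀ ε : ℝ, (H + (ε : ℂ) • V).minEnergyOn K ≤ H.minEnergyOn K

/-- HOW IT IS USED (glue, proved): any certified lower bound `c` for the DEFORMED operator on the
sector is a lower bound for the symmetric one. With `H` = the `L × L` torus Hubbard Hamiltonian,
`K` = its `N`-particle (`S_z = 0`) sector, `V` = a translation-invariant `g`-odd kinetic term and
`c = lo · L²` from a window/SOS certificate for `H + εV`, the existing thermodynamic-limit
transport (`energyDensityTT'_ge_of_eventually_ge_torus`) then yields `M3EnergyLowerRow 0 lo`. -/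
theorem lowerBound_transfer (hT : OddDeformationTransfer)
    {n : Type} [Fintype n] [DecidableEq n] (H V g : Matrix n n ℂ) (K : Submodule ℂ (n → ℂ))
    (hH : H.IsHermitian) (hV : V.IsHermitian) (hg : gᴴ * g = 1) (hgH : g * H = H * g)
    (hgV : g * V = -(V * g)) (hK : ∀ ψ ∈ K, g *ᵥ ψ ∈ K) (ε c : ℝ)
    (hc : c ≤ (H + (ε : ℂ) • V).minEnergyOn K) :
    c ≤ H.minEnergyOn K :=
  hc.trans (hT n H V g K hH hV hg hgH hgV hK ε)

/-- The measured object of the falsifier (engine side, recorded here only as a definition of terms):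
for a relaxation value `R : ℝ → ℝ` (even in `ε` by construction) the line is LIVE iff `R ε > R 0`
for some `ε`; with `R` twice differentiable at `0` this is decided to leading order by the sign of
the curvature `r₂`. Nothing to prove. -/
def LiveAt (R : ℝ → ℝ) (ε : ℝ) : Prop := R 0 < R ε

end Summit.Ventures.CertifiedManyBodySolver.Cruxes.LowerEdge_ge_m4o5.OddDeformation
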